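import Literature.Geometry.Lorentzian.OpensChartGeodesicODE
import Literature.Geometry.Lorentzian.GeodesicExtension
import Literature.Geometry.Lorentzian.GeodesicUniformTime
import Literature.Geometry.Lorentzian.GeodesicSpeed
import Literature.Geometry.Lorentzian.FutureNullCompleteness
import Literature.Geometry.Lorentzian.LeviCivitaProofs
import Literature.Geometry.Lorentzian.GeodesicMaximal
import Literature.Geometry.Lorentzian.GeodesicMaximalFlow
import Literature.Geometry.Lorentzian.CommonDevelopmentRigidity
import Summits.FinalStateConjecture.FinalStateConjecture.Theses.StarvedNecks
import Summits.FinalStateConjecture.FinalStateConjecture.Theorems.StarvedNecksHonestFixedRadiusSettlingStubFlatZoneSojournODE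
import Summits.FinalStateConjecture.FinalStateConjecture.Theorems.StarvedNecksHonestFixedRadiusSettlingStubFlatZoneSojournTransport

/-!
# `stub_flatZoneSojourn` — the lever of line `sojourn-needs-only-one-over-delta`
(crux `StarvedNecks.HonestFixedRadiusSettling`, item stmt-FinalStateConjecture-13550)

**Statement** (registered stub, proved with `C = 9`, `δ₀ = 1/3`). If a maximal geodesic `γ` of a
vacuum development passes at parameter `s` through a late flat-charted point `Φ y` with null
velocity `Φ_* w`, `0 < w⁰ ≤ L`, the flat chart's `C¹` deviation from `η` is `≤ δ ≤ δ₀` on the flat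
slabs of chart time in `[y⁰, y⁰ + T]`, and the coordinate cone `K` of height `T` over `y` lies in
`flatDomain`, then `γ` survives at least affine time `(1 - e^{-CδT})/(CδL)` after `s`.

**Proof.**
* §1 `chart_sojourn` (registered form `flatChart_sojourn`) — the endgame in a chart: for a smooth
  metric `h` on `U : Opens E4` with components `G`, `‖G - η‖ ≤ δ ≤ 1/3`, `‖DG‖ ≤ δ` on `K ⊆ U`, a
  MAXIMAL `h`-geodesic `ζ` entering `K` at `ζ 0 = y` with null velocity of chart rate
  `0 < ζ'(0)⁰ ≤ L` is defined on `[0, (1 - e^{-9δT})/(9δL)]`: its 1-jet solves the coordinate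
  geodesic equations (`OpensChart.hasDerivAt_of_isGeodesicOn`), stays null
  (`val_velocity_eq_of_isGeodesicOn_holds`) and nonvanishing (`IsGeodesicOn.velocity_ne_zero`); on
  `K` the chart algebra of the landed transport file (`null_cone_estimate`, `norm_christoffel_le`)
  feeds the landed coordinate lever `cone_confinement`, which confines `ζ` to `K` with
  `‖ζ'‖ ≤ 2Le^{9δT}`; if `dom ζ` ended at `b ≤ Δ` the tangent lift on `[0, b)` would lie in a
  compact subset of `TU` with a uniform existence time (`exists_uniform_isGeodesicOn_of_isCompact`),
  and gluing (`IsGeodesicOn.piecewise`) a local geodesic near `b` would contradict maximality.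
* §2 `stub_flatZoneSojourn` — assembly: the components `G = η + e` of `Φ^* g` are smooth
  (`contDiffAt_components`), the slab bounds give `‖e‖, ‖De‖ ≤ δ` on `K` (`deviation_bounds`), on
  `U' = {‖e‖ < 1/2} ⊇ K` the differential `dΦ` is injective
  (`injective_mfderiv_of_norm_deviation_lt`), so `h = (Φ|U')^* g` (`PseudoRiemannianMetric.comap`)
  is a metric on `U'` with components `G`; §1 applies to the maximal `h`-geodesic `ζ` from
  `(y, w)`; `Φ ∘ ζ` is a `g`-geodesic (`isGeodesicOn_comp_of_comap`) with the tangent lift of `γ`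
  at `s`; gluing it to the maximal translate `u ↦ γ (u + s)` gives `dom - s ⊇ dom ζ ⊇ [0, Δ]`.
-/

noncomputable section

set_option linter.dupNamespace false
-- nested operator types `E4 →L[ℝ] E4 →L[ℝ] E4 →L[ℝ] ℝ` (as in `CoordCurvature.lean`)
set_option maxSynthPendingDepth 3

open Literature.Geometry.Lorentzian
open scoped Manifold ContDiff ENNReal Topology
open Filter Set MeasureTheory Topology Bundle

namespace Summit.FinalStateConjecture.FinalStateConjecture.Theorems.StarvedNecks.OneOverDelta

/-! ## §1 The endgame in a nearly flat chart -/

section ChartEndgame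

variable {U : TopologicalSpace.Opens E4}

/-- The closed coordinate cone `{x | y⁰ ≤ x⁰ ≤ y⁰ + T, ‖x⃗ - y⃗‖ ≤ 2(x⁰ - y⁰) + 1}` is compact. -/
theorem isCompact_coordCone (y : E4) (T : ℝ) :
    IsCompact {x : E4 | y 0 ≤ x 0 ∧ x 0 ≤ y 0 + T ∧
      ‖E4.spatial x - E4.spatial y‖ ≤ 2 * (x 0 - y 0) + 1} := by
  have h0 : Continuous fun x : E4 ↦ x 0 := (EuclideanSpace.proj (0 : Fin 4) : E4 →L[ℝ] ℝ).continuous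
  refine Metric.isCompact_of_isClosed_isBounded ?_ ?_
  · exact (isClosed_le continuous_const h0).inter ((isClosed_le h0 continuous_const).inter
      (isClosed_le (E4.spatial.continuous.sub continuous_const).norm
        ((continuous_const.mul (h0.sub continuous_const)).add continuous_const)))
  · rw [isBounded_iff_forall_norm_le]
    refine ⟨3 * T + 1 + ‖y‖, fun x ⟨h1, h2, h3⟩ ↦ ?_⟩
    have hsq := Minkowski.norm_sq_eq_time_sq_add_norm_spatial_sq (x - y)
    have h4 : (x - y) 0 = x 0 - y 0 := by simp
    have h5 : E4.spatial (x - y) = E4.spatial x - E4.spatial y := by simp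
    rw [h4, h5] at hsq
    have h6 : ‖x - y‖ ≤ 3 * T + 1 := by
      have h7 : ‖x - y‖ ^ 2 ≤ (3 * T + 1) ^ 2 := by
        rw [hsq]; nlinarith [norm_nonneg (E4.spatial x - E4.spatial y)]
      exact (pow_le_pow_iff_left₀ (norm_nonneg _) (by linarith) two_ne_zero).1 h7
    linarith [norm_le_norm_sub_add x y]

variable (h : PseudoRiemannianMetric 𝓘(ℝ, E4) ∞ E4 (TangentSpace 𝓘(ℝ, E4) : U → Type _))
  [h.HasLeviCivita]

/-- The Levi-Civita connection of a smooth metric on `U : Opens E4` is `C¹`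
(`isLocallyContMDiff_leviCivita_holds`; cf. `FlatDevelopment.lean`). -/
theorem contMDiffCovariantDerivative_leviCivita_one :
    CovariantDerivative.ContMDiffCovariantDerivative h.leviCivita 1 :=
  ⟨h.isLocallyContMDiff_leviCivita_holds 1
    (by rw [show ((1 : ℕ∞) : ℕ∞ω) + 1 = 2 by norm_num]; exact WithTop.coe_le_coe.2 le_top)
    univ isOpen_univ⟩

/-- **The sojourn lemma in a nearly flat chart** (see the module docstring, §1): a maximal geodesic
`ζ` of a smooth metric `h` on `U : Opens E4` with differentiable components `G`, entering at
`ζ 0 = y` the coordinate cone of height `T` (contained in `U`, with `‖G - η‖ ≤ δ ≤ 1/3`,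
`‖DG‖ ≤ δ` there) with null velocity of chart rate `0 < ζ'(0)⁰ ≤ L`, is defined on
`[0, (1 - e^{-9δT})/(9δL)]`. -/
theorem chart_sojourn (G : E4 → E4 →L[ℝ] E4 →L[ℝ] ℝ) (hG : ∀ x : U, h.val x = G x)
    (hGd : ∀ x : U, DifferentiableAt ℝ G x) {ζ : ℝ → U} {D : Set ℝ}
    (hζ : IsMaximalGeodesicOn h.leviCivita ζ D) (h0 : (0 : ℝ) ∈ D) {y : E4} (hy : (ζ 0 : E4) = y)
    {L δ T : ℝ} (hδ : 0 < δ) (hδ3 : δ ≤ 1 / 3) (hT : 0 ≤ T)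
    (hw0 : 0 < (show E4 from velocity 𝓘(ℝ, E4) ζ 0) 0)
    (hwL : (show E4 from velocity 𝓘(ℝ, E4) ζ 0) 0 ≤ L)
    (hnull : h.val (ζ 0) (velocity 𝓘(ℝ, E4) ζ 0) (velocity 𝓘(ℝ, E4) ζ 0) = 0)
    (hcone : ∀ x : E4, y 0 ≤ x 0 → x 0 ≤ y 0 + T →
      ‖E4.spatial x - E4.spatial y‖ ≤ 2 * (x 0 - y 0) + 1 →
      x ∈ (U : Set E4) ∧ ‖G x - Minkowski.bilin‖ ≤ δ ∧ ‖fderiv ℝ G x‖ ≤ δ) :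
    Icc 0 ((1 - Real.exp (-(9 * δ * T))) / (9 * δ * L)) ⊆ D := by
  haveI := contMDiffCovariantDerivative_leviCivita_one h
  obtain ⟨hDo, hDc, hgeo, hmax⟩ := hζ
  set z : ℝ → E4 := fun t ↦ (ζ t : E4) with hz_def
  set v : ℝ → E4 := fun t ↦ (velocity 𝓘(ℝ, E4) ζ t : E4) with hv_def
  set a : ℝ → E4 := fun t ↦ -OpensChart.christoffel h G (ζ t) (v t) (v t) with ha_def
  set Δ : ℝ := (1 - Real.exp (-(9 * δ * T))) / (9 * δ * L) with hΔ_def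
  -- (1) the coordinate geodesic equations
  have hode : ∀ t ∈ D, HasDerivAt z (v t) t ∧ HasDerivAt v (a t) t := fun t ht ↦
    OpensChart.hasDerivAt_of_isGeodesicOn hG hGd hgeo ht
  -- (2) the velocity never vanishes
  have hv0ne : velocity 𝓘(ℝ, E4) ζ 0 ≠ 0 := fun h0' ↦ by
    have : v 0 0 = 0 := by simp only [hv_def, h0']; rfl
    exact hw0.ne' this
  have hne : ∀ t ∈ D, v t ≠ 0 := fun t ht ↦ hgeo.velocity_ne_zero hDo hDc h0 hv0ne ht
  -- (3) nullness propagates along the geodesic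
  have hnullt : ∀ t ∈ D,
      Minkowski.bilin (v t) (v t) + (G (z t) - Minkowski.bilin) (v t) (v t) = 0 := by
    intro t ht
    have h1 := h.val_velocity_eq_of_isGeodesicOn_holds hDo hDc hgeo ht h0
    rw [hnull, hG] at h1
    simp only [sub_apply]
    have h2 : G (z t) (v t) (v t) = 0 := h1
    linarith
  -- (4) pointwise bounds in the cone
  have hbounds : ∀ t ∈ D, y 0 ≤ z t 0 → z t 0 ≤ y 0 + T →
      ‖E4.spatial (z t) - E4.spatial y‖ ≤ 2 * (z t 0 - y 0) + 1 →
      ‖v t‖ ^ 2 ≤ 3 * v t 0 ^ 2 ∧ |a t 0| ≤ 9 * δ * v t 0 ^ 2 := by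
    intro t ht h1 h2 h3
    obtain ⟨-, he, hde⟩ := hcone (z t) h1 h2 h3
    have hn := null_cone_estimate hδ3 he (hnullt t ht)
    refine ⟨hn, ?_⟩
    have hΓ := norm_christoffel_le h G hG hδ3 he hde (v t) (v t)
    have h4 : |a t 0| ≤ ‖a t‖ := by
      rw [← Real.norm_eq_abs]; exact PiLp.norm_apply_le (a t) 0
    have h5 : ‖a t‖ = ‖OpensChart.christoffel h G (ζ t) (v t) (v t)‖ := norm_neg _
    calc |a t 0| ≤ ‖a t‖ := h4
      _ ≤ 3 * δ * ‖v t‖ * ‖v t‖ := by rw [h5]; exact hΓ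
      _ = δ * (3 * ‖v t‖ ^ 2) := by ring
      _ ≤ δ * (3 * (3 * v t 0 ^ 2)) := by gcongr
      _ = 9 * δ * v t 0 ^ 2 := by ring
  -- (5) cone confinement on `D ∩ [0, Δ]`
  have hconf : ∀ t ∈ D, 0 ≤ t → t ≤ Δ → (y 0 ≤ z t 0 ∧ z t 0 ≤ y 0 + T ∧
      ‖E4.spatial (z t) - E4.spatial y‖ ≤ 2 * (z t 0 - y 0) + 1) ∧
      ‖v t‖ ≤ 2 * L * Real.exp (9 * δ * T) := by
    intro t ht ht0 htΔ
    have hsub : Icc 0 t ⊆ D := fun u hu ↦ hDc.out h0 ht hu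
    have key := cone_confinement (z := z) (v := v) (a := a) (y := y) (s := 0) (t₁ := t) (L := L)
      (δ := δ) (T := T) (C := 9) (by norm_num) hδ hT hy hw0 hwL (by rw [zero_add]; exact htΔ)
      (fun u hu ↦ (hode u (hsub hu)).1) (fun u hu ↦ (hode u (hsub hu)).2)
      (fun u hu ↦ hne u (hsub hu))
      (fun u hu h1 h2 h3 ↦ (hbounds u (hsub hu) h1 h2 h3).1)
      (fun u hu h1 h2 h3 ↦ (hbounds u (hsub hu) h1 h2 h3).2) t (right_mem_Icc.2 ht0)
    exact ⟨key.1, key.2.2⟩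
  -- (6) the escape argument: if `[0, Δ] ⊄ D` then `D` ends at some `b ≤ Δ` ...
  by_contra hnot
  obtain ⟨tstar, htstar, htstarD⟩ : ∃ t ∈ Icc 0 Δ, t ∉ D := not_subset.1 hnot
  have hlt : ∀ t ∈ D, t < tstar := fun t ht ↦
    lt_of_not_ge fun hle ↦ htstarD (hDc.out h0 ht ⟨htstar.1, hle⟩)
  have hbdd : BddAbove D := ⟨tstar, fun t ht ↦ (hlt t ht).le⟩
  set b := sSup D with hb_def
  have hbt : b ≤ tstar := csSup_le ⟨0, h0⟩ fun t ht ↦ (hlt t ht).le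
  have hbD : b ∉ D := fun hb ↦ by
    obtain ⟨ε, hε, hball⟩ := Metric.isOpen_iff.1 hDo b hb
    have hmem : b + ε / 2 ∈ D := hball (by
      rw [Metric.mem_ball, Real.dist_eq, add_sub_cancel_left, abs_of_pos (by linarith)]
      linarith)
    have := le_csSup hbdd hmem
    linarith
  have h0b : 0 < b := by
    obtain ⟨ε, hε, hball⟩ := Metric.isOpen_iff.1 hDo 0 h0
    have hmem : ε / 2 ∈ D := hball (by
      rw [Metric.mem_ball, Real.dist_eq, sub_zero, abs_of_pos (by linarith)]
      linarith)
    exact lt_of_lt_of_le (by linarith) (le_csSup hbdd hmem)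
  have hIco : Ico 0 b ⊆ D := fun t ht ↦ by
    obtain ⟨t', ht'D, htt'⟩ := exists_lt_of_lt_csSup ⟨0, h0⟩ ht.2
    exact hDc.out h0 ht'D ⟨ht.1, htt'.le⟩
  have hbΔ : b ≤ Δ := hbt.trans htstar.2
  -- ... and the tangent lift of `ζ` on `[0, b)` lies in a compact subset of `TU`
  set B : ℝ := 2 * L * Real.exp (9 * δ * T) with hB_def
  set K' : Set U := Subtype.val ⁻¹' {x : E4 | y 0 ≤ x 0 ∧ x 0 ≤ y 0 + T ∧
    ‖E4.spatial x - E4.spatial y‖ ≤ 2 * (x 0 - y 0) + 1} with hK'_def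
  have hK'c : IsCompact K' := by
    refine Topology.IsInducing.subtypeVal.isCompact_preimage' (isCompact_coordCone y T) ?_
    intro x hx
    exact ⟨⟨x, (hcone x hx.1 hx.2.1 hx.2.2).1⟩, rfl⟩
  set e := trivializationAt E4 (TangentSpace 𝓘(ℝ, E4)) (ζ 0) with he_def
  have hebase : e.baseSet = univ := by
    rw [he_def, TangentBundle.trivializationAt_baseSet, OpensChart.chartAt_source]
  set 𝒦 : Set (TangentBundle 𝓘(ℝ, E4) U) :=
    (fun p : U × E4 ↦ (TotalSpace.mk' E4 p.1 (e.symm p.1 p.2) : TangentBundle 𝓘(ℝ, E4) U)) ''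
      (K' ×ˢ Metric.closedBall (0 : E4) B) with h𝒦_def
  have h𝒦 : IsCompact 𝒦 :=
    (hK'c.prod (isCompact_closedBall 0 B)).image_of_continuousOn
      (e.continuousOn_symm.mono (by rw [hebase]; exact prod_mono (subset_univ _) (subset_univ _)))
  have hmem : ∀ t ∈ Ico 0 b, tangentLift 𝓘(ℝ, E4) ζ t ∈ 𝒦 := by
    intro t ht
    have htD := hIco ht
    obtain ⟨hc, hvB⟩ := hconf t htD ht.1 (ht.2.le.trans hbΔ)
    refine ⟨(ζ t, v t), ⟨hc, ?_⟩, ?_⟩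
    · rw [Metric.mem_closedBall, dist_zero_right]; exact hvB
    · show TotalSpace.mk' E4 (ζ t) (e.symm (ζ t) (v t)) = tangentLift 𝓘(ℝ, E4) ζ t
      rw [he_def, OpensChart.trivializationAt_symm_apply]
      rfl
  -- uniform existence time on `𝒦`, extension past `b`, contradiction with maximality
  obtain ⟨ε, hε, hunif⟩ := exists_uniform_isGeodesicOn_of_isCompact (cov := h.leviCivita) h𝒦
  set t₁ : ℝ := max 0 (b - ε / 2) with ht₁_def
  have ht₁0 : 0 ≤ t₁ := le_max_left _ _
  have ht₁b : t₁ < b := max_lt h0b (by linarith)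
  have ht₁D : t₁ ∈ D := hIco ⟨ht₁0, ht₁b⟩
  have hbt₁ : b < t₁ + ε := by
    have := le_max_right 0 (b - ε / 2)
    linarith
  obtain ⟨β, hβ, hβ0⟩ := hunif _ (hmem t₁ ⟨ht₁0, ht₁b⟩)
  classical
  have hβ' : IsGeodesicOn h.leviCivita (fun t ↦ β (t - t₁)) (Ioo (t₁ - ε) (t₁ + ε)) := by
    refine (hβ.comp_sub_const t₁).mono fun t ht ↦ ?_
    simp only [mem_preimage, mem_Ioo] at ht ⊢
    constructor <;> linarith [ht.1, ht.2]
  have ht₁V : t₁ ∈ Ioo (t₁ - ε) (t₁ + ε) := ⟨by linarith, by linarith⟩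
  have hlift : tangentLift 𝓘(ℝ, E4) ζ t₁ = tangentLift 𝓘(ℝ, E4) (fun t ↦ β (t - t₁)) t₁ := by
    rw [tangentLift_comp_sub_const β t₁ t₁, sub_self, hβ0]
  obtain ⟨hg, hgζ, -⟩ := hgeo.piecewise hDo isOpen_Ioo (hDc.inter ordConnected_Ioo) hβ'
    ⟨ht₁D, ht₁V⟩ hlift
  have hUc : (D ∪ Ioo (t₁ - ε) (t₁ + ε)).OrdConnected := by
    rw [← isPreconnected_iff_ordConnected]
    exact IsPreconnected.union t₁ ht₁D ht₁V hDc.isPreconnected ordConnected_Ioo.isPreconnected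
  have hU : D ∪ Ioo (t₁ - ε) (t₁ + ε) = D :=
    hmax _ _ (hDo.union isOpen_Ioo) hUc subset_union_left hg hgζ.symm
  have hbV : b ∈ D ∪ Ioo (t₁ - ε) (t₁ + ε) := Or.inr ⟨by linarith, hbt₁⟩
  rw [hU] at hbV
  exact hbD hbV

/-- **The sojourn lemma in a nearly flat chart, registered form** (the sub-goal `flatChart_sojourn`
of crux item stmt-FinalStateConjecture-13550, line `sojourn-needs-only-one-over-delta`): the
statement of `chart_sojourn` as one closed proposition. -/
theorem flatChart_sojourn : ∀ {U : TopologicalSpace.Opens E4} (h : PseudoRiemannianMetric 𝓘(ℝ, E4) ∞ E4 (TangentSpace 𝓘(ℝ, E4) : U → Type _)) [h.HasLeviCivita] (G : E4 → E4 →L[ℝ] E4 →L[ℝ] ℝ), (∀ x : U, h.val x = G x) → (∀ x : U, DifferentiableAt ℝ G x) → ∀ {ζ : ℝ → U} {D : Set ℝ}, IsMaximalGeodesicOn h.leviCivita ζ D → (0 : ℝ) ∈ D → ∀ {y : E4}, (ζ 0 : E4) = y → ∀ {L δ T : ℝ}, 0 < δ → δ ≤ 1 / 3 → 0 ≤ T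 → 0 < (show E4 from velocity 𝓘(ℝ, E4) ζ 0) 0 → (show E4 from velocity 𝓘(ℝ, E4) ζ 0) 0 ≤ L → h.val (ζ 0) (velocity 𝓘(ℝ, E4) ζ 0) (velocity 𝓘(ℝ, E4) ζ 0) = 0 → (∀ x : E4, y 0 ≤ x 0 → x 0 ≤ y 0 + T → ‖E4.spatial x - E4.spatial y‖ ≤ 2 * (x 0 - y 0) + 1 → x ∈ (U : Set E4) ∧ ‖G x - Minkowski.bilin‖ ≤ δ ∧ ‖fderiv ℝ G x‖ ≤ δ) → Icc 0 ((1 - Real.exp (-(9 * δ * T))) / (9 * δ * L)) ⊆ D :=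
  fun h _ G hG hGd _ _ hζ h0 _ hy _ _ _ hδ hδ3 hT hw0 hwL hnull hcone ↦
    chart_sojourn h G hG hGd hζ h0 hy hδ hδ3 hT hw0 hwL hnull hcone

end ChartEndgame

/-! ## §2 Assembly -/

/-- **FLAT-ZONE SOJOURN** (THE LEVER of line `sojourn-needs-only-one-over-delta`; registered stub
`stub_flatZoneSojourn` of crux item stmt-FinalStateConjecture-13550, here with `C = 9`,
`δ₀ = 1/3`). In a flat chart with rate-free `C¹` deviation `≤ δ` on the slabs `[y⁰, y⁰ + T]`, a
maximal geodesic entering the coordinate cone over `y` with null velocity `Φ_* w`, `0 < w⁰ ≤ L`,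
survives affine time `≥ (1 - e^{-CδT})/(CδL)`: one-sided Grönwall read backwards
(`cone_confinement`), the escape argument in the chart (`chart_sojourn`), and transport of chart
geodesics to the spacetime (`isGeodesicOn_comp_of_comap`) glued to `γ` by maximality. -/
theorem stub_flatZoneSojourn :
    ∃ C : ℝ, 0 < C ∧ ∃ δ₀ : ℝ, 0 < δ₀ ∧
    ∀ (X : Type) [TopologicalSpace X] [ChartedSpace E3 X] [IsManifold (𝓡 3) ∞ X] [T2Space X]
      [SecondCountableTopology X] [ConnectedSpace X] (D : InitialDataSet (𝓡 3) X)
      (𝒟 : VacuumCauchyDevelopment D) (O : Set 𝒟.carrier) (k : ℕ) (d : FinalStateDecomposition 𝒟.toSpacetime O k),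
      ∀ [𝒟.metric.HasLeviCivita] (γ : ℝ → 𝒟.carrier) (dom : Set ℝ),
        IsMaximalGeodesicOn 𝒟.metric.leviCivita γ dom →
        ∀ (s : ℝ) (y : d.flatDomain) (w : E4) (L δ T : ℝ),
          s ∈ dom → γ s = d.flatChart y → d.τ₀ < y.1 0 →
          velocity (𝓡 4) γ s = mfderiv 𝓘(ℝ, E4) (𝓡 4) d.flatChart y w →
          𝒟.metric.IsNull (velocity (𝓡 4) γ s) → 0 < w 0 → w 0 ≤ L → 0 < δ → δ ≤ δ₀ → 0 ≤ T →
          (∀ τ' : ℝ, y.1 0 ≤ τ' → τ' ≤ y.1 0 + T →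
            𝒟.toSpacetime.deviationCk (Minkowski.backgroundOn d.flatDomain) d.flatChart 1 τ' ≤ ENNReal.ofReal δ) →
          {z : E4 | y.1 0 ≤ z 0 ∧ z 0 ≤ y.1 0 + T ∧ ‖E4.spatial z - E4.spatial y.1‖ ≤ 2 * (z 0 - y.1 0) + 1} ⊆
            (d.flatDomain : Set E4) →
          ∀ s' : ℝ, s ≤ s' → s' ≤ s + (1 - Real.exp (-(C * δ * T))) / (C * δ * L) → s' ∈ dom := by
  refine ⟨9, by norm_num, 1 / 3, by norm_num, ?_⟩
  intro X _ _ _ _ _ _ D 𝒟 O k d _ γ dom hγ s y w L δ T hs hγs hτ hvel hnull hw0 hwL hδ hδ₀ hT hdev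
    hK s' hss' hs'
  classical
  -- the flat chart, its smooth components `G = η + e` and the deviation `e`
  have hΦ : ContMDiff 𝓘(ℝ, E4) (𝓡 4) ∞ d.flatChart := d.isLateChart_flat.contMDiff
  set dev : E4 → E4 →L[ℝ] E4 →L[ℝ] ℝ :=
    𝒟.toSpacetime.deviationExtend (Minkowski.backgroundOn d.flatDomain) d.flatChart with hdev_def
  obtain ⟨G, hGΦ, hGs, hGdef⟩ : ∃ G : E4 → E4 →L[ℝ] E4 →L[ℝ] ℝ,
      (∀ x : d.flatDomain, (pullbackBilin (I := 𝓡 4) (I' := 𝓘(ℝ, E4)) d.flatChart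
        𝒟.metric.val x : E4 →L[ℝ] E4 →L[ℝ] ℝ) = G x) ∧
      (∀ x : d.flatDomain, ContDiffAt ℝ ∞ G x) ∧ ∀ x, G x = Minkowski.bilin + dev x :=
    ⟨fun x ↦ Minkowski.bilin + dev x, fun x ↦ (contDiffAt_components 𝒟.toSpacetime hΦ x).1 x,
      fun x ↦ (contDiffAt_components 𝒟.toSpacetime hΦ x).2, fun x ↦ rfl⟩
  have hGfun : G = fun x ↦ Minkowski.bilin + dev x := funext hGdef
  have hcont : ∀ x ∈ (d.flatDomain : Set E4), ContinuousAt dev x := by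
    intro x hx
    have h1 : ContinuousAt G x := (hGs ⟨x, hx⟩).continuousAt
    have h2 : dev = fun z ↦ G z - Minkowski.bilin := by
      funext z; rw [hGdef]; abel
    rw [h2]
    exact h1.sub continuousAt_const
  -- the good open set `U'` (deviation `< 1/2`, so that `dΦ` is injective) and the chart `Φ'`
  let U' : TopologicalSpace.Opens E4 :=
    ⟨{x | x ∈ (d.flatDomain : Set E4) ∧ ‖dev x‖ < 1 / 2}, isOpen_iff_mem_nhds.2 fun x hx ↦
      Filter.inter_mem (d.flatDomain.isOpen.mem_nhds hx.1)
        ((hcont x hx.1).norm.eventually_lt continuousAt_const hx.2)⟩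
  have hle : U' ≤ d.flatDomain := fun x hx ↦ hx.1
  let Φ' : U' → 𝒟.carrier := d.flatChart ∘ TopologicalSpace.Opens.inclusion hle
  have hΦ' : ContMDiff 𝓘(ℝ, E4) (𝓡 4) ((∞ : ℕ∞ω) + 1) Φ' :=
    (hΦ.comp (contMDiff_inclusion hle)).of_le (le_of_eq (by rfl))
  have hmf : ∀ x : U', mfderiv 𝓘(ℝ, E4) (𝓡 4) Φ' x =
      mfderiv 𝓘(ℝ, E4) (𝓡 4) d.flatChart (TopologicalSpace.Opens.inclusion hle x) := fun x ↦
    mfderiv_comp_inclusion hle ((hΦ _).mdifferentiableAt (by simp))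
  have hinj : ∀ x : U', Function.Injective (mfderiv 𝓘(ℝ, E4) (𝓡 4) Φ' x) := by
    intro x
    rw [hmf x]
    refine injective_mfderiv_of_norm_deviation_lt 𝒟.toSpacetime hΦ _ ?_
    have := x.2.2
    show ‖dev x‖ < 1
    linarith
  -- the pulled-back metric `h = Φ'^* g` on `U'` and its Levi-Civita connection
  set gP := 𝒟.metric.toPseudoRiemannianMetric with hgP_def
  haveI : CovariantDerivative.ContMDiffCovariantDerivative gP.leviCivita 1 :=
    ⟨gP.isLocallyContMDiff_leviCivita_holds 1
      (by rw [show ((1 : ℕ∞) : ℕ∞ω) + 1 = 2 by norm_num]; exact WithTop.coe_le_coe.2 le_top)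
      univ isOpen_univ⟩
  let h := gP.comap PseudoRiemannianMetric.contMDiff_pullbackBilin_holds Φ' hΦ' hinj rfl
  haveI : h.HasLeviCivita := h.hasLeviCivita
  haveI := contMDiffCovariantDerivative_leviCivita_one h
  have hGh : ∀ x : U', h.val x = G x := by
    intro x
    rw [← hGΦ (TopologicalSpace.Opens.inclusion hle x)]
    ext v v'
    show gP.val (Φ' x) (mfderiv 𝓘(ℝ, E4) (𝓡 4) Φ' x v) (mfderiv 𝓘(ℝ, E4) (𝓡 4) Φ' x v') = _
    rw [hmf x]
    rfl
  have hGd : ∀ x : U', DifferentiableAt ℝ G x := fun x ↦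
    (hGs (TopologicalSpace.Opens.inclusion hle x)).differentiableAt (by simp)
  -- pointwise `C¹` control of the components on the coordinate cone
  have hcone : ∀ x : E4, y.1 0 ≤ x 0 → x 0 ≤ y.1 0 + T →
      ‖E4.spatial x - E4.spatial y.1‖ ≤ 2 * (x 0 - y.1 0) + 1 →
      x ∈ (U' : Set E4) ∧ ‖G x - Minkowski.bilin‖ ≤ δ ∧ ‖fderiv ℝ G x‖ ≤ δ := by
    intro x h1 h2 h3
    have hxU : x ∈ (d.flatDomain : Set E4) := hK ⟨h1, h2, h3⟩
    obtain ⟨he, hde⟩ := deviation_bounds 𝒟.toSpacetime d.flatChart hδ.le hxU (hdev (x 0) h1 h2)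
    refine ⟨⟨hxU, ?_⟩, ?_, ?_⟩
    · show ‖dev x‖ < 1 / 2
      linarith
    · rw [hGdef, add_sub_cancel_left]; exact he
    · rw [hGfun, fderiv_const_add]; exact hde
  -- the entry point in `U'` and the maximal geodesic `ζ` of `h` issuing from `(y, w)`
  have hyU' : y.1 ∈ (U' : Set E4) := (hcone y.1 le_rfl (by linarith) (by simp)).1
  set y' : U' := ⟨y.1, hyU'⟩ with hy'_def
  obtain ⟨ζ, D₀, ⟨hζ, h0D, hζ0, hζv⟩, -⟩ :=
    existsUnique_isMaximalGeodesicOn_holds (cov := h.leviCivita) y' (show E4 from w)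
  -- the sojourn lemma in the chart: `[0, Δ] ⊆ D₀`
  have hnullg : gP.val (d.flatChart y) (mfderiv 𝓘(ℝ, E4) (𝓡 4) d.flatChart y w)
      (mfderiv 𝓘(ℝ, E4) (𝓡 4) d.flatChart y w) = 0 := by
    have h1 := hnull.1
    rw [hvel] at h1
    rw [hγs] at h1
    exact h1
  have hnullh : h.val (ζ 0) (velocity 𝓘(ℝ, E4) ζ 0) (velocity 𝓘(ℝ, E4) ζ 0) = 0 := by
    rw [hζv, hζ0, hGh, ← hGΦ]
    exact hnullg
  have hw0' : 0 < (show E4 from velocity 𝓘(ℝ, E4) ζ 0) 0 := by rw [hζv]; exact hw0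
  have hwL' : (show E4 from velocity 𝓘(ℝ, E4) ζ 0) 0 ≤ L := by rw [hζv]; exact hwL
  have hsoj := chart_sojourn h G hGh hGd hζ h0D (y := y.1) (by rw [hζ0]) hδ hδ₀ hT hw0' hwL'
    hnullh hcone
  -- `Φ' ∘ ζ` is a geodesic of `g`; glue it to the translate `u ↦ γ (u + s)` and use maximality
  obtain ⟨hgeoM, hvelM⟩ := isGeodesicOn_comp_of_comap gP
    PseudoRiemannianMetric.contMDiff_pullbackBilin_holds hΦ' hinj rfl hζ.isOpen hζ.isGeodesicOn
  obtain ⟨hTo, hTc, hTg, hTmax⟩ := hγ.comp_add s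
  have h0T : (0 : ℝ) ∈ {u : ℝ | u + s ∈ dom} := by
    show (0 : ℝ) + s ∈ dom
    rw [zero_add]; exact hs
  have hlift : tangentLift (𝓡 4) (fun u ↦ γ (u - (-s))) 0 = tangentLift (𝓡 4) (Φ' ∘ ζ) 0 := by
    rw [tangentLift_comp_sub_const γ (-s) 0, show (0 : ℝ) - (-s) = s by ring]
    refine TotalSpace.ext ?_ (heq_of_eq ?_)
    · show γ s = Φ' (ζ 0)
      rw [hζ0, hγs]
      rfl
    · show velocity (𝓡 4) γ s = velocity (𝓡 4) (Φ' ∘ ζ) 0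
      rw [hvelM 0 h0D, hζv, hvel, hζ0, hmf]
      rfl
  obtain ⟨hglue, hglueγ, -⟩ := hTg.piecewise hTo hζ.isOpen (hTc.inter hζ.2.1) hgeoM ⟨h0T, h0D⟩
    hlift
  have hUc : ({u : ℝ | u + s ∈ dom} ∪ D₀).OrdConnected := by
    rw [← isPreconnected_iff_ordConnected]
    exact IsPreconnected.union 0 h0T h0D hTc.isPreconnected hζ.2.1.isPreconnected
  have hEq : {u : ℝ | u + s ∈ dom} ∪ D₀ = {u : ℝ | u + s ∈ dom} :=
    hTmax _ _ (hTo.union hζ.isOpen) hUc subset_union_left hglue hglueγ.symm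
  have hmem : s' - s ∈ D₀ := hsoj ⟨by linarith, by linarith⟩
  have hmem' : s' - s ∈ {u : ℝ | u + s ∈ dom} ∪ D₀ := Or.inr hmem
  rw [hEq] at hmem'
  have : s' - s + s ∈ dom := hmem'
  rwa [sub_add_cancel] at this

end Summit.FinalStateConjecture.FinalStateConjecture.Theorems.StarvedNecks.OneOverDelta

end
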